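import Summits.CriticalPhenomena.PercolationContinuityZ3.Theorems.PercNearOneGluingNoHeavyLowerTailWorstPairExchangeCex

/-!
# `NoHeavyLowerTail` (crux stmt-CriticalPhenomena-4575): the GREEDY COMPARATOR CONDITION (GCC) is FALSE —
# ttrl2's certified weighted witness W1 on six vertices

The support file `PercNearOneGluingNoHeavyLowerTailGreedyComparator.lean` (lemma factory `prim-lf-6`, 2026-08-19)
reduces the crux `NoHeavyLowerTail` (via `stub_cumulativeIsolation` and CST@champion) to ONE comparator condition, the
hypothesis `hGCC` of `noHeavyLowerTail_of_greedyComparator` (formerly the registered stub `stub_greedyComparator`,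
expired): for `μ = prodBernoulli w` on `Fin n`, relays `A`, an observer set `T` disjoint from `A`, a champion `i`
(maximiser over `A` of the lightness `I_w(b) = μ(|π(b)| ≤ j)`) and some boundary pair of `T` of non-zero weight, SOME
boundary pair `e = s(y,z)` and SOME champion `i₁` of `w[e ↦ 0]` satisfy `q_w(T,i₁) ≤ q_w(T,i)`
(`q_w(T,d) = μ(d ↮ T, |π(d)| ≤ j) + μ(d ↔ T, |π(T)| ≤ j)`, the lightness of `d` with `T` contracted).

ttrl2's exact census (`run/shared/lean/ttrl/lf6/GCC.md`, RESULT 1, 2026-08-19) found 127 violations among 7.0·10⁷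
instances; the smallest, W1, is certified here: `n = 6`, relays `A = {0,1,2}`, level `j = 1`, observer set
`T = {4,5}`, weights `w(0,3) = 1/2`, `w(0,5) = 3/4`, `w(1,3) = 7/8`, `w(2,4) = 1/2`, `w(2,5) = 1/2`, `w(3,4) = 7/8`
(all other pairs `0`), champion `i = 1` (`2¹¹·I_w = (685, 760, 755)` on `A`).  The boundary pairs of non-zero weight
are `s(4,2), s(4,3), s(5,0), s(5,2)`; zeroing any one of them makes `2` the UNIQUE champion
(`2¹¹·I = (720, 1152, 1280)` for `s(4,2), s(4,3)`, `(1096, 760, 1208)` for `s(5,0), s(5,2)`), and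
`2¹¹·q_w(T,·) = (336, 417, 581)` on `A`: the only admissible designee `i₁ = 2` has `q_w(T,2) > q_w(T,1)`.
(CST@champion itself HOLDS at W1 — the refuted object is the single-pair / single-designee comparator, not the
observer-set line; `…PivotCertificate.lean` has the sound general calculus, which certifies W1 with per-branch designees.)

Method (as in `…WorstPairExchangeCex.lean` / `…LinearInclusiveCex.lean`): the weighted certificate machinery of
`AdditiveGluing/Negative/CertWeighted.lean` (`wOfList`, `wtabs`) and `real_eq_wcount`: every probability occurring in GCC
at the witness is the exact weighted count of a `Bool` test on the reach tables of the `2⁶` sub-configurations, and the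
rational comparisons are decided by `native_decide`.  The modified weight function `w[p ↦ 0]` of a weighted edge list is
again a weighted edge list (`update_wOfList_eq`: map the weight of `p` to `0`).  Computational file; no sorries, no
definitions (tests and lists are written inline).
-/

namespace Summit.CriticalPhenomena.PercolationContinuityZ3.Theorems

open MeasureTheory
open Literature.Probability.LatticeModels Literature.Probability.Percolation
open Summit.CriticalPhenomena.PercolationContinuityZ3.Theorems.AdditiveGluing.Negative.Cert
open WorstPairExchangeCex
open scoped Classical

namespace GreedyComparatorCex

/-! ### Zeroing one weight stays inside the weighted-edge-list format -/

/-- Zeroing the weight of `p` does not change the pairs. [this file] -/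
theorem wPairs_map_zero {n : ℕ} (p : Sym2 (Fin n)) : ∀ l : List (Fin n × Fin n × ℚ),
    wPairs (l.map fun e => if mkE (e.1, e.2.1) = p then (e.1, e.2.1, (0 : ℚ)) else e) = wPairs l
  | [] => rfl
  | e :: l => by
    have ih := wPairs_map_zero p l
    simp only [wPairs, List.map_cons, List.map_map] at ih ⊢
    rw [ih]
    split_ifs <;> rfl

/-- Zeroing the weight of `p` keeps the weights in `[0,1]`. [this file] -/
theorem weights_map_zero {n : ℕ} (p : Sym2 (Fin n)) (l : List (Fin n × Fin n × ℚ))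
    (h : ∀ e ∈ l, 0 ≤ e.2.2 ∧ e.2.2 ≤ 1) :
    ∀ e ∈ (l.map fun e => if mkE (e.1, e.2.1) = p then (e.1, e.2.1, (0 : ℚ)) else e), 0 ≤ e.2.2 ∧ e.2.2 ≤ 1 := by
  intro e' he'
  obtain ⟨e, he, rfl⟩ := List.mem_map.1 he'
  split_ifs
  · exact ⟨le_rfl, zero_le_one⟩
  · exact h e he

/-- **`w[p ↦ 0]` of a weighted edge list is the weighted edge list with the weight of `p` mapped to `0`.** [this file] -/
theorem update_wOfList_eq {n : ℕ} (p : Sym2 (Fin n)) : ∀ l : List (Fin n × Fin n × ℚ),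
    Function.update (wOfList l) p 0 = wOfList (l.map fun e => if mkE (e.1, e.2.1) = p then (e.1, e.2.1, (0 : ℚ)) else e)
  | [] => by
    funext x
    rw [Function.update_apply]
    split_ifs <;> rfl
  | e :: l => by
    funext x
    have ih := congrFun (update_wOfList_eq p l) x
    rw [Function.update_apply] at ih ⊢
    rw [List.map_cons]
    by_cases hep : mkE (e.1, e.2.1) = p
    · simp only [hep, if_true, wOfList]
      by_cases hx : x = p
      · rw [if_pos hx, if_pos (hx.trans (by rfl))]
        ext
        simp
      · rw [← ih]
        simp only [if_neg hx]
    · simp only [hep, if_false, wOfList]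
      by_cases hx : x = p
      · rw [if_pos hx, if_neg (fun h => hep (h.symm.trans hx)), ← ih, if_pos hx]
      · rw [if_neg hx]
        by_cases hxe : x = mkE (e.1, e.2.1)
        · rw [if_pos hxe, if_pos hxe]
        · rw [if_neg hxe, if_neg hxe, ← ih, if_neg hx]

/-! ### Identification of the three kinds of probabilities with weighted counts (`A = {0,1,2}`, `T = {4,5}`, `j = 1`) -/

/-- Cardinality of a filter of `{0,1,2}`. [this file] -/
theorem card_filter_three (p : Fin 6 → Prop) [DecidablePred p] :
    (({0, 1, 2} : Finset (Fin 6)).filter p).card =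
      (if p 0 then 1 else 0) + (if p 1 then 1 else 0) + (if p 2 then 1 else 0) := by
  rw [Finset.card_filter, Finset.sum_insert (by decide), Finset.sum_insert (by decide), Finset.sum_singleton]
  ring

/-- `(if b then 1 else 0) = b.toNat` for any decidability instance. [this file] -/
theorem ite_eq_toNat (b : Bool) [Decidable (b = true)] : (if b = true then 1 else 0 : ℕ) = b.toNat := by
  cases b <;> simp

/-- `(if b ∨ b' then 1 else 0) = (b || b').toNat` for any decidability instance. [this file] -/
theorem ite_or_eq_toNat (b b' : Bool) [Decidable (b = true ∨ b' = true)] :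
    (if (b = true ∨ b' = true) then 1 else 0 : ℕ) = (b || b').toNat := by
  cases b <;> cases b' <;> simp

/-- The lightness `I(v) = μ(|π(v)| ≤ 1)` as a weighted count. [this file] -/
theorem real_light {l : List (Fin 6 × Fin 6 × ℚ)} (hnd : (wPairs l).Nodup) (hq : ∀ e ∈ l, 0 ≤ e.2.2 ∧ e.2.2 ≤ 1)
    (v : Fin 6) :
    (prodBernoulli
          (wOfList l)).real
        {ω : BondConfig (Fin 6) | (({0, 1, 2} : Finset (Fin 6)).filter fun x => ω ∈ openConn v x).card ≤ 1} =
      ((((wtabs 6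
        l).map fun t =>
        if (fun tb : List ℕ => decide (((tb.getD v 0).testBit 0).toNat + ((tb.getD v 0).testBit 1).toNat + ((tb.getD v 0).testBit 2).toNat ≤ 1)) t.1
        then t.2 else 0).sum : ℚ) : ℝ) := by
  refine real_eq_wcount hnd hq (fun tb : List ℕ => decide (((tb.getD v 0).testBit 0).toNat + ((tb.getD v 0).testBit 1).toNat + ((tb.getD v 0).testBit 2).toNat ≤ 1)) _ fun ω => ?_
  simp only [decide_eq_true_eq, Set.mem_setOf_eq, card_filter_three]
  simp only [← testBit_reachTable_iff_mem_openConn, ite_eq_toNat]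
  exact Iff.rfl

/-- `μ(v ↮ T, |π(v)| ≤ 1)` as a weighted count. [this file] -/
theorem real_E1 {l : List (Fin 6 × Fin 6 × ℚ)} (hnd : (wPairs l).Nodup) (hq : ∀ e ∈ l, 0 ≤ e.2.2 ∧ e.2.2 ≤ 1)
    (v : Fin 6) :
    (prodBernoulli
          (wOfList l)).real
        {ω : BondConfig (Fin 6) | (∀ t ∈ ({4, 5} : Finset (Fin 6)), ω ∉ openConn v t) ∧
          (({0, 1, 2} : Finset (Fin 6)).filter fun x => ω ∈ openConn v x).card ≤ 1} =
      ((((wtabs 6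
        l).map fun t =>
        if (fun tb : List ℕ => !(tb.getD v 0).testBit 4 && !(tb.getD v 0).testBit 5 &&
          decide (((tb.getD v 0).testBit 0).toNat + ((tb.getD v 0).testBit 1).toNat + ((tb.getD v 0).testBit 2).toNat ≤ 1)) t.1
        then t.2 else 0).sum : ℚ) : ℝ) := by
  refine real_eq_wcount hnd hq (fun tb : List ℕ => !(tb.getD v 0).testBit 4 && !(tb.getD v 0).testBit 5 &&
          decide (((tb.getD v 0).testBit 0).toNat + ((tb.getD v 0).testBit 1).toNat + ((tb.getD v 0).testBit 2).toNat ≤ 1)) _ fun ω => ?_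
  simp only [Bool.and_eq_true, Bool.not_eq_true', decide_eq_true_eq, Set.mem_setOf_eq,
    card_filter_three, Finset.mem_insert, Finset.mem_singleton, forall_eq_or_imp, forall_eq]
  simp only [← testBit_reachTable_iff_mem_openConn, ite_eq_toNat, Bool.not_eq_true]
  exact Iff.rfl

/-- `μ(v ↔ T, |π(T)| ≤ 1)` as a weighted count. [this file] -/
theorem real_Q {l : List (Fin 6 × Fin 6 × ℚ)} (hnd : (wPairs l).Nodup) (hq : ∀ e ∈ l, 0 ≤ e.2.2 ∧ e.2.2 ≤ 1)
    (v : Fin 6) :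
    (prodBernoulli
          (wOfList l)).real
        {ω : BondConfig (Fin 6) | (∃ t ∈ ({4, 5} : Finset (Fin 6)), ω ∈ openConn v t) ∧
          (({0, 1, 2} : Finset (Fin 6)).filter fun x => ∃ t ∈ ({4, 5} : Finset (Fin 6)), ω ∈ openConn t x).card ≤ 1} =
      ((((wtabs 6
        l).map fun t =>
        if (fun tb : List ℕ => ((tb.getD v 0).testBit 4 || (tb.getD v 0).testBit 5) &&
          decide ((((tb.getD 4 0).testBit 0 || (tb.getD 5 0).testBit 0).toNat +
            ((tb.getD 4 0).testBit 1 || (tb.getD 5 0).testBit 1).toNat +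
            ((tb.getD 4 0).testBit 2 || (tb.getD 5 0).testBit 2).toNat) ≤ 1)) t.1
        then t.2 else 0).sum : ℚ) : ℝ) := by
  refine real_eq_wcount hnd hq (fun tb : List ℕ => ((tb.getD v 0).testBit 4 || (tb.getD v 0).testBit 5) &&
          decide ((((tb.getD 4 0).testBit 0 || (tb.getD 5 0).testBit 0).toNat +
            ((tb.getD 4 0).testBit 1 || (tb.getD 5 0).testBit 1).toNat +
            ((tb.getD 4 0).testBit 2 || (tb.getD 5 0).testBit 2).toNat) ≤ 1)) _ fun ω => ?_
  simp only [Bool.and_eq_true, Bool.or_eq_true, decide_eq_true_eq, Set.mem_setOf_eq, card_filter_three,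
    Finset.mem_insert, Finset.mem_singleton, exists_eq_or_imp, exists_eq_left]
  simp only [← testBit_reachTable_iff_mem_openConn, ite_or_eq_toNat]
  exact Iff.rfl

/-! ### The facts about W1 = `[((0 : Fin 6), (3 : Fin 6), (1/2 : ℚ)), (0, 5, 3/4), (1, 3, 7/8), (2, 4, 1/2), (2, 5, 1/2), (3, 4, 7/8)]` -/

/-- W1 has distinct pairs. [this file] -/
theorem W1_nodup : (wPairs [((0 : Fin 6), (3 : Fin 6), (1/2 : ℚ)), (0, 5, 3/4), (1, 3, 7/8), (2, 4, 1/2), (2, 5, 1/2), (3, 4, 7/8)]).Nodup := by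
  decide

/-- W1 has weights in `[0,1]`. [this file] -/
theorem W1_weights : ∀ e ∈ [((0 : Fin 6), (3 : Fin 6), (1/2 : ℚ)), (0, 5, 3/4), (1, 3, 7/8), (2, 4, 1/2), (2, 5, 1/2), (3, 4, 7/8)], 0 ≤ e.2.2 ∧ e.2.2 ≤ 1 := by
  intro e he
  simp only [List.mem_cons, List.not_mem_nil, or_false] at he
  rcases he with rfl | rfl | rfl | rfl | rfl | rfl <;> norm_num

/-- The weight of the boundary pair `s(4,3)` is non-zero (`7/8`). [this file] -/
theorem W1_43_ne_zero : wOfList [((0 : Fin 6), (3 : Fin 6), (1/2 : ℚ)), (0, 5, 3/4), (1, 3, 7/8), (2, 4, 1/2), (2, 5, 1/2), (3, 4, 7/8)] s(4, 3) ≠ 0 := by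
  intro h
  have h' := congrArg (fun u : unitInterval => (u : ℝ)) h
  simp [wOfList, mkE] at h'
  norm_num at h'

/-- `1` is a champion of W1: `I(b) ≤ I(1)` for `b ∈ {0,1,2}` (`2¹¹·I = (685, 760, 755)`). [this file] -/
theorem W1_champion : ∀ b ∈ ({0, 1, 2} : Finset (Fin 6)),
    (prodBernoulli
          (wOfList [((0 : Fin 6), (3 : Fin 6), (1/2 : ℚ)), (0, 5, 3/4), (1, 3, 7/8), (2, 4, 1/2), (2, 5, 1/2), (3, 4, 7/8)])).real
        {ω : BondConfig (Fin 6) | (({0, 1, 2} : Finset (Fin 6)).filter fun x => ω ∈ openConn b x).card ≤ 1} ≤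
      (prodBernoulli
          (wOfList [((0 : Fin 6), (3 : Fin 6), (1/2 : ℚ)), (0, 5, 3/4), (1, 3, 7/8), (2, 4, 1/2), (2, 5, 1/2), (3, 4, 7/8)])).real
        {ω : BondConfig (Fin 6) | (({0, 1, 2} : Finset (Fin 6)).filter fun x => ω ∈ openConn 1 x).card ≤ 1} := by
  intro b hb
  rw [real_light W1_nodup W1_weights, real_light W1_nodup W1_weights]
  simp only [Finset.mem_insert, Finset.mem_singleton] at hb
  have hle : (((wtabs 6
        [((0 : Fin 6), (3 : Fin 6), (1/2 : ℚ)), (0, 5, 3/4), (1, 3, 7/8), (2, 4, 1/2), (2, 5, 1/2), (3, 4, 7/8)]).map fun t =>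
        if (fun tb : List ℕ => decide (((tb.getD b 0).testBit 0).toNat + ((tb.getD b 0).testBit 1).toNat + ((tb.getD b 0).testBit 2).toNat ≤ 1)) t.1
        then t.2 else 0).sum : ℚ) ≤
      (((wtabs 6
        [((0 : Fin 6), (3 : Fin 6), (1/2 : ℚ)), (0, 5, 3/4), (1, 3, 7/8), (2, 4, 1/2), (2, 5, 1/2), (3, 4, 7/8)]).map fun t =>
        if (fun tb : List ℕ => decide (((tb.getD (1 : Fin 6) 0).testBit 0).toNat + ((tb.getD (1 : Fin 6) 0).testBit 1).toNat + ((tb.getD (1 : Fin 6) 0).testBit 2).toNat ≤ 1)) t.1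
        then t.2 else 0).sum : ℚ) := by
    rcases hb with rfl | rfl | rfl <;> native_decide
  exact_mod_cast hle

/-- The boundary pairs `s(y,z)` (`y ∈ T = {4,5}`, `z ∉ T`) of non-zero weight are `s(4,2), s(4,3), s(5,0), s(5,2)`.
[this file] -/
theorem W1_boundary (y z : Fin 6) (hy : y ∈ ({4, 5} : Finset (Fin 6))) (hz : z ∉ ({4, 5} : Finset (Fin 6)))
    (hw : wOfList [((0 : Fin 6), (3 : Fin 6), (1/2 : ℚ)), (0, 5, 3/4), (1, 3, 7/8), (2, 4, 1/2), (2, 5, 1/2), (3, 4, 7/8)] s(y, z) ≠ 0) :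
    s(y, z) = s(4, 2) ∨ s(y, z) = s(4, 3) ∨ s(y, z) = s(5, 0) ∨ s(y, z) = s(5, 2) := by
  simp only [Finset.mem_insert, Finset.mem_singleton] at hy
  rcases hy with rfl | rfl <;> fin_cases z <;>
    first
      | exact absurd (by decide) hz
      | exact absurd (wOfList_eq_zero _ _ (by decide)) hw
      | decide

/-- After zeroing any positive boundary pair `p`, the relay `2` is the UNIQUE champion: a champion `i₁ ∈ {0,1,2}` of
`w[p ↦ 0]` equals `2` (`2¹¹·I = (720, 1152, 1280)` resp. `(1096, 760, 1208)`). [this file] -/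
theorem W1_designee_eq_two (p : Sym2 (Fin 6))
    (hp : p = s(4, 2) ∨ p = s(4, 3) ∨ p = s(5, 0) ∨ p = s(5, 2)) (i₁ : Fin 6)
    (hi₁ : i₁ ∈ ({0, 1, 2} : Finset (Fin 6)))
    (hch : ∀ b ∈ ({0, 1, 2} : Finset (Fin 6)),
      (prodBernoulli
          (Function.update (wOfList [((0 : Fin 6), (3 : Fin 6), (1/2 : ℚ)), (0, 5, 3/4), (1, 3, 7/8), (2, 4, 1/2), (2, 5, 1/2), (3, 4, 7/8)]) p 0)).real
        {ω : BondConfig (Fin 6) | (({0, 1, 2} : Finset (Fin 6)).filter fun x => ω ∈ openConn b x).card ≤ 1} ≤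
        (prodBernoulli
          (Function.update (wOfList [((0 : Fin 6), (3 : Fin 6), (1/2 : ℚ)), (0, 5, 3/4), (1, 3, 7/8), (2, 4, 1/2), (2, 5, 1/2), (3, 4, 7/8)]) p 0)).real
        {ω : BondConfig (Fin 6) | (({0, 1, 2} : Finset (Fin 6)).filter fun x => ω ∈ openConn i₁ x).card ≤ 1}) :
    i₁ = 2 := by
  have hnd := wPairs_map_zero p [((0 : Fin 6), (3 : Fin 6), (1/2 : ℚ)), (0, 5, 3/4), (1, 3, 7/8), (2, 4, 1/2), (2, 5, 1/2), (3, 4, 7/8)]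
  have hnd' : (wPairs ((([((0 : Fin 6), (3 : Fin 6), (1/2 : ℚ)), (0, 5, 3/4), (1, 3, 7/8), (2, 4, 1/2), (2, 5, 1/2), (3, 4, 7/8)]).map
          fun e => if mkE (e.1, e.2.1) = p then (e.1, e.2.1, (0 : ℚ)) else e))).Nodup := by
    rw [hnd]; exact W1_nodup
  have hq' := weights_map_zero p [((0 : Fin 6), (3 : Fin 6), (1/2 : ℚ)), (0, 5, 3/4), (1, 3, 7/8), (2, 4, 1/2), (2, 5, 1/2), (3, 4, 7/8)] W1_weights
  have h2 := hch 2 (by decide)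
  rw [update_wOfList_eq, real_light hnd' hq', real_light hnd' hq'] at h2
  simp only [Finset.mem_insert, Finset.mem_singleton] at hi₁
  by_contra hne
  have hi₁' : i₁ = 0 ∨ i₁ = 1 := by tauto
  have hlt : (((wtabs 6
        (([((0 : Fin 6), (3 : Fin 6), (1/2 : ℚ)), (0, 5, 3/4), (1, 3, 7/8), (2, 4, 1/2), (2, 5, 1/2), (3, 4, 7/8)]).map
          fun e => if mkE (e.1, e.2.1) = p then (e.1, e.2.1, (0 : ℚ)) else e)).map fun t =>
        if (fun tb : List ℕ => decide (((tb.getD i₁ 0).testBit 0).toNat + ((tb.getD i₁ 0).testBit 1).toNat + ((tb.getD i₁ 0).testBit 2).toNat ≤ 1)) t.1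
        then t.2 else 0).sum : ℚ) <
      (((wtabs 6
        (([((0 : Fin 6), (3 : Fin 6), (1/2 : ℚ)), (0, 5, 3/4), (1, 3, 7/8), (2, 4, 1/2), (2, 5, 1/2), (3, 4, 7/8)]).map
          fun e => if mkE (e.1, e.2.1) = p then (e.1, e.2.1, (0 : ℚ)) else e)).map fun t =>
        if (fun tb : List ℕ => decide (((tb.getD (2 : Fin 6) 0).testBit 0).toNat + ((tb.getD (2 : Fin 6) 0).testBit 1).toNat + ((tb.getD (2 : Fin 6) 0).testBit 2).toNat ≤ 1)) t.1
        then t.2 else 0).sum : ℚ) := by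
    rcases hp with rfl | rfl | rfl | rfl <;> rcases hi₁' with rfl | rfl <;> native_decide
  exact absurd h2 (not_le.2 (by exact_mod_cast hlt))

/-- The comparator fails for the designee `2` against the champion `1`: `q(T,1) < q(T,2)` (`417 < 581` in units of
`2⁻¹¹`). [this file] -/
theorem W1_comparator_lt :
    (prodBernoulli
          (wOfList [((0 : Fin 6), (3 : Fin 6), (1/2 : ℚ)), (0, 5, 3/4), (1, 3, 7/8), (2, 4, 1/2), (2, 5, 1/2), (3, 4, 7/8)])).real
        {ω : BondConfig (Fin 6) | (∀ t ∈ ({4, 5} : Finset (Fin 6)), ω ∉ openConn 1 t) ∧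
          (({0, 1, 2} : Finset (Fin 6)).filter fun x => ω ∈ openConn 1 x).card ≤ 1} +
        (prodBernoulli
          (wOfList [((0 : Fin 6), (3 : Fin 6), (1/2 : ℚ)), (0, 5, 3/4), (1, 3, 7/8), (2, 4, 1/2), (2, 5, 1/2), (3, 4, 7/8)])).real
        {ω : BondConfig (Fin 6) | (∃ t ∈ ({4, 5} : Finset (Fin 6)), ω ∈ openConn 1 t) ∧
          (({0, 1, 2} : Finset (Fin 6)).filter fun x => ∃ t ∈ ({4, 5} : Finset (Fin 6)), ω ∈ openConn t x).card ≤ 1} <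
      (prodBernoulli
          (wOfList [((0 : Fin 6), (3 : Fin 6), (1/2 : ℚ)), (0, 5, 3/4), (1, 3, 7/8), (2, 4, 1/2), (2, 5, 1/2), (3, 4, 7/8)])).real
        {ω : BondConfig (Fin 6) | (∀ t ∈ ({4, 5} : Finset (Fin 6)), ω ∉ openConn 2 t) ∧
          (({0, 1, 2} : Finset (Fin 6)).filter fun x => ω ∈ openConn 2 x).card ≤ 1} +
        (prodBernoulli
          (wOfList [((0 : Fin 6), (3 : Fin 6), (1/2 : ℚ)), (0, 5, 3/4), (1, 3, 7/8), (2, 4, 1/2), (2, 5, 1/2), (3, 4, 7/8)])).real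
        {ω : BondConfig (Fin 6) | (∃ t ∈ ({4, 5} : Finset (Fin 6)), ω ∈ openConn 2 t) ∧
          (({0, 1, 2} : Finset (Fin 6)).filter fun x => ∃ t ∈ ({4, 5} : Finset (Fin 6)), ω ∈ openConn t x).card ≤ 1} := by
  rw [real_E1 W1_nodup W1_weights, real_Q W1_nodup W1_weights, real_E1 W1_nodup W1_weights,
    real_Q W1_nodup W1_weights]
  have hlt : (((wtabs 6
        [((0 : Fin 6), (3 : Fin 6), (1/2 : ℚ)), (0, 5, 3/4), (1, 3, 7/8), (2, 4, 1/2), (2, 5, 1/2), (3, 4, 7/8)]).map fun t =>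
        if (fun tb : List ℕ => !(tb.getD (1 : Fin 6) 0).testBit 4 && !(tb.getD (1 : Fin 6) 0).testBit 5 &&
          decide (((tb.getD (1 : Fin 6) 0).testBit 0).toNat + ((tb.getD (1 : Fin 6) 0).testBit 1).toNat + ((tb.getD (1 : Fin 6) 0).testBit 2).toNat ≤ 1)) t.1
        then t.2 else 0).sum : ℚ) + (((wtabs 6
        [((0 : Fin 6), (3 : Fin 6), (1/2 : ℚ)), (0, 5, 3/4), (1, 3, 7/8), (2, 4, 1/2), (2, 5, 1/2), (3, 4, 7/8)]).map fun t =>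
        if (fun tb : List ℕ => ((tb.getD (1 : Fin 6) 0).testBit 4 || (tb.getD (1 : Fin 6) 0).testBit 5) &&
          decide ((((tb.getD 4 0).testBit 0 || (tb.getD 5 0).testBit 0).toNat +
            ((tb.getD 4 0).testBit 1 || (tb.getD 5 0).testBit 1).toNat +
            ((tb.getD 4 0).testBit 2 || (tb.getD 5 0).testBit 2).toNat) ≤ 1)) t.1
        then t.2 else 0).sum : ℚ) <
      (((wtabs 6
        [((0 : Fin 6), (3 : Fin 6), (1/2 : ℚ)), (0, 5, 3/4), (1, 3, 7/8), (2, 4, 1/2), (2, 5, 1/2), (3, 4, 7/8)]).map fun t =>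
        if (fun tb : List ℕ => !(tb.getD (2 : Fin 6) 0).testBit 4 && !(tb.getD (2 : Fin 6) 0).testBit 5 &&
          decide (((tb.getD (2 : Fin 6) 0).testBit 0).toNat + ((tb.getD (2 : Fin 6) 0).testBit 1).toNat + ((tb.getD (2 : Fin 6) 0).testBit 2).toNat ≤ 1)) t.1
        then t.2 else 0).sum : ℚ) + (((wtabs 6
        [((0 : Fin 6), (3 : Fin 6), (1/2 : ℚ)), (0, 5, 3/4), (1, 3, 7/8), (2, 4, 1/2), (2, 5, 1/2), (3, 4, 7/8)]).map fun t =>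
        if (fun tb : List ℕ => ((tb.getD (2 : Fin 6) 0).testBit 4 || (tb.getD (2 : Fin 6) 0).testBit 5) &&
          decide ((((tb.getD 4 0).testBit 0 || (tb.getD 5 0).testBit 0).toNat +
            ((tb.getD 4 0).testBit 1 || (tb.getD 5 0).testBit 1).toNat +
            ((tb.getD 4 0).testBit 2 || (tb.getD 5 0).testBit 2).toNat) ≤ 1)) t.1
        then t.2 else 0).sum : ℚ) := by
    native_decide
  exact_mod_cast hlt

end GreedyComparatorCex

open GreedyComparatorCex

/-- **The greedy comparator condition (GCC; formerly stub `stub_greedyComparator` of crux stmt-CriticalPhenomena-4575)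
is FALSE.**  The negated statement is, verbatim, the hypothesis `hGCC` of `noHeavyLowerTail_of_greedyComparator` /
`cumulativeIsolation_of_greedyComparator` / `A_nonneg_of_greedyComparator` (`PercNearOneGluingNoHeavyLowerTailGreedyComparator.lean`).
Witness: ttrl2's W1 (`n = 6`, `A = {0,1,2}`, `T = {4,5}`, `j = 1`, `i = 1`; see the header).  Consequence for the route:
the reductions through GCC are vacuous; the observer-set line itself is NOT refuted (CST@champion holds at W1, and W1 is
certified by the pivot calculus of `…PivotCertificate.lean` with per-branch champion designees). [this file] -/
theorem greedyComparator_false :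
    ¬ (∀ (n : ℕ) (w : Sym2 (Fin n) → unitInterval) (A T : Finset (Fin n)) (j : ℕ) (i : Fin n),
      Disjoint T A → i ∈ A →
      (∀ b ∈ A, (prodBernoulli w).real {ω : BondConfig (Fin n) | (A.filter fun x => ω ∈ openConn b x).card ≤ j} ≤
        (prodBernoulli w).real {ω : BondConfig (Fin n) | (A.filter fun x => ω ∈ openConn i x).card ≤ j}) →
      (∃ y ∈ T, ∃ z : Fin n, z ∉ T ∧ w s(y, z) ≠ 0) →
      ∃ y ∈ T, ∃ z : Fin n, z ∉ T ∧ w s(y, z) ≠ 0 ∧ ∃ i₁ ∈ A,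
        (∀ b ∈ A, (prodBernoulli (Function.update w s(y, z) 0)).real {ω : BondConfig (Fin n) | (A.filter fun x => ω ∈ openConn b x).card ≤ j} ≤
          (prodBernoulli (Function.update w s(y, z) 0)).real {ω : BondConfig (Fin n) | (A.filter fun x => ω ∈ openConn i₁ x).card ≤ j}) ∧
        (prodBernoulli w).real {ω : BondConfig (Fin n) | (∀ t ∈ T, ω ∉ openConn i₁ t) ∧ (A.filter fun x => ω ∈ openConn i₁ x).card ≤ j} +
            (prodBernoulli w).real {ω : BondConfig (Fin n) | (∃ t ∈ T, ω ∈ openConn i₁ t) ∧ (A.filter fun x => ∃ t ∈ T, ω ∈ openConn t x).card ≤ j} ≤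
          (prodBernoulli w).real {ω : BondConfig (Fin n) | (∀ t ∈ T, ω ∉ openConn i t) ∧ (A.filter fun x => ω ∈ openConn i x).card ≤ j} +
            (prodBernoulli w).real {ω : BondConfig (Fin n) | (∃ t ∈ T, ω ∈ openConn i t) ∧ (A.filter fun x => ∃ t ∈ T, ω ∈ openConn t x).card ≤ j}) := by
  intro h
  obtain ⟨y, hy, z, hz, hw, i₁, hi₁, hch, hq⟩ :=
    h 6 (wOfList [((0 : Fin 6), (3 : Fin 6), (1/2 : ℚ)), (0, 5, 3/4), (1, 3, 7/8), (2, 4, 1/2), (2, 5, 1/2), (3, 4, 7/8)]) {0, 1, 2} {4, 5} 1 1 (by decide) (by decide)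
      W1_champion ⟨4, by decide, 3, by decide, W1_43_ne_zero⟩
  have hp := W1_boundary y z hy hz hw
  have hi : i₁ = 2 := W1_designee_eq_two (s(y, z)) hp i₁ hi₁ hch
  subst hi
  exact absurd hq (not_le.2 W1_comparator_lt)

end Summit.CriticalPhenomena.PercolationContinuityZ3.Theorems
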